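import Mathlib.RingTheory.Smooth.AdicCompletion
import Mathlib.RingTheory.Ideal.Quotient.Operations
import Mathlib.RingTheory.LocalRing.MaximalIdeal.Basic
import HarnessLib

/-!
# [OURS · L1 W4.5(b) · EL♮(3) · booked widening D18♯ «PARAMETER FORM of the DESCENT-CERTIFICATE DOOR», engine lemma (pre-draft)]
# `DescSharp.exists_ringHom_lift` — a formally smooth `R`-algebra `B` with a point `θ : B → k` lifts along any surjection
# `π : O → k` from an `𝔪`-adically complete local `R`-algebra `O` with `ker π = 𝔪`

res-L1-w45b-nose-w1 g8 (WIDTH seat D-0157 DOOR 1), PRE-DRAFT AT OWN RISK for the booked widening D18♯ of desk RULING R88 (5)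
(2026-08-29T14:09Z: «D18♯ = parameter form: `DescDoorOver B` for B SMOOTH over ℤ[1/N] with a GIVEN θ : B →+* k (engine lifts θ to 𝕎(k)
by formal smoothness + p-adic completeness — one real lemma)»; sizing res-L1-w45b-idea-2 g32 `D18-WIDENINGS-idea2.md` v1 b6219fcc98ba39fb
(`DescDoorAt B θ`, `DescDoorSharp` with `Algebra.FormallySmooth (Localization.Away (N:ℤ)) B`)).  NOT dealt; NO letters typed; nothing here is
registered.  This file is the «one real lemma» only, and it is Mathlib's: `Algebra.FormallySmooth.exists_mkₐ_comp_eq_of_isAdicComplete`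
(Ludwig–Merten: a formally smooth `R`-algebra map `B →ₐ[R] O ⧸ I` lifts to `B →ₐ[R] O` when `O` is `I`-adically complete) dressed for the
engine: the given point `θ : B →+* k` is read as `B →ₐ[R] O ⧸ 𝔪` through `O ⧸ ker π ≃ k` (Mathlib `RingHom.quotientKerEquivOfSurjective`).
With `η` in hand the D18♯ engine is ✓/⊙ `descDoorOver_elnat_of_base` (…NatNoseDescEngine, this seat: the O-UNIFORM D18 engine, any
`B`-algebra structure on `O`) called at `Algebra B O := η.toAlgebra` — the door's `θ`-clause is then hit because `π ∘ η = θ`.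
OURS; NOT a statement of any manuscript ([Hironaka2017] is a candidate under adjudication, nothing of it is asserted); AI-written, weaker
than expert review.  DEF-FREE; no `sorry`; standard axioms; Mathlib-only imports.  `--supports stmt-ResolutionOfSingularities-20148 --as helper`
(only if/when D18♯ is dealt), counted 0.  EL♮(3) NOT proved; resolution in char p NOT proved.
[cite: StacksProject, Tag 07K9 (formally smooth lifts along complete ideals)] (method; Mathlib proof)
-/

set_option linter.dupNamespace false -- mandated namespace `Summit.<Summit>.<Problem>` of this single-conjunct summit

namespace Summit.ResolutionOfSingularities.ResolutionOfSingularities.Cruxes.EquisingularLiftNat.Sections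

/-- ★ **`DescSharp.exists_ringHom_lift` — THE D18♯ LIFT.**  Let `B` be a formally smooth `R`-algebra, `O` an `R`-algebra which is a local
ring complete for its maximal ideal `𝔪`, `π : O → k` a surjective ring map onto a field with `ker π = 𝔪`, and `θ : B → k` a ring map
compatible with the structure maps (`θ ∘ (R → B) = π ∘ (R → O)`).  Then `θ` LIFTS: there is `η : B →+* O` over `R` with `π ∘ η = θ`.
Proof: `O ⧸ ker π ≃ k` turns `θ` into an `R`-algebra map `B → O ⧸ 𝔪`; Mathlib's `Algebra.FormallySmooth.exists_mkₐ_comp_eq_of_isAdicComplete`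
lifts it to `B → O` (successive square-zero lifts `O ⧸ 𝔪ⁿ⁺¹ → O ⧸ 𝔪ⁿ` + completeness). [cite: StacksProject, Tag 07K9]
[OURS · L1 W4.5b · D18♯ engine lemma, pre-draft]; NOT a statement of the manuscript. -/
theorem DescSharp.exists_ringHom_lift {R B O k : Type*} [CommRing R] [CommRing B] [Algebra R B] [Algebra.FormallySmooth R B]
    [CommRing O] [IsLocalRing O] [IsAdicComplete (IsLocalRing.maximalIdeal O) O] [Algebra R O] [Field k]
    (π : O →+* k) (hπ : Function.Surjective π) (hker : RingHom.ker π = IsLocalRing.maximalIdeal O)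
    (θ : B →+* k) (hθ : θ.comp (algebraMap R B) = π.comp (algebraMap R O)) :
    ∃ η : B →+* O, π.comp η = θ ∧ η.comp (algebraMap R B) = algebraMap R O := by
  classical
  -- `O` is `ker π`-adically complete
  haveI : IsAdicComplete (RingHom.ker π) O := by rw [hker]; infer_instance
  -- `O ⧸ ker π ≃ k`
  let e : O ⧸ RingHom.ker π ≃+* k := RingHom.quotientKerEquivOfSurjective hπ
  -- `θ` as an `R`-algebra map `B → O ⧸ ker π`
  let f : B →ₐ[R] O ⧸ RingHom.ker π :=
    { (e.symm : k →+* O ⧸ RingHom.ker π).comp θ with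
      commutes' := fun r => by
        show e.symm (θ (algebraMap R B r)) = algebraMap R (O ⧸ RingHom.ker π) r
        have h1 : θ (algebraMap R B r) = π (algebraMap R O r) := by
          simpa using RingHom.congr_fun hθ r
        rw [h1, RingHom.quotientKerEquivOfSurjective_symm_apply, Ideal.Quotient.mk_algebraMap] }
  -- the formally smooth lift
  obtain ⟨g, hg⟩ := Algebra.FormallySmooth.exists_mkₐ_comp_eq_of_isAdicComplete (I := RingHom.ker π) f
  refine ⟨g.toRingHom, ?_, ?_⟩
  · ext b
    have h2 : (Ideal.Quotient.mk (RingHom.ker π)) (g b) = f b := by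
      simpa using AlgHom.congr_fun hg b
    have h3 : e (f b) = θ b := by
      show e (e.symm (θ b)) = θ b
      exact e.apply_symm_apply _
    rw [RingHom.comp_apply]
    show π (g b) = θ b
    rw [← h3, ← h2]
    exact (RingHom.quotientKerEquivOfSurjective_apply_mk hπ (g b)).symm
  · exact g.comp_algebraMap

end Summit.ResolutionOfSingularities.ResolutionOfSingularities.Cruxes.EquisingularLiftNat.Sections
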